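import Literature.NumberTheory.GaloisRepresentations.TateDualLimitLocalPairing
import Literature.NumberTheory.GaloisRepresentations.PontryaginTateDualInverseLimitEquivariance
import HarnessLib

/-!
# The `Λ`-adic local pairing is adjoint for the endomorphisms of `D`: `⟪θ_* t, y⟫ = ⟪t, θ̂_* y⟫`

Topic `NumberTheory/GaloisRepresentations`; namespace
`Literature.NumberTheory.GaloisRepresentations.DiscreteGaloisModule.TorsionLayers`; sequel of
`TateDualLimitLocalPairing.lean`.  THEOREMS ONLY (no definition, no named fact, no `sorry`, no
instance).  Lane «SUR-Λ» of cell `bsd-eis` (road memo `SUR-LAMBDA-ROAD-w5g9.md`, asked for by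
brick C4 = Greenberg 2010 Prop. 2.3.2 and used by C5 (β)), `--supports stmt-BirchSwinnertonDyer-19032`.

For a layer-preserving additive `θ : D → D` commuting with `Γ_K` (e.g. a scalar of `Λ`) and the induced
endomorphism `θ̂` of `T* = lim_k Hom(D_k, μ_{p^k})`, `(θ̂ x)(d) = x(θ d)` (the tree's `E.dualEnd` /
`E.dualEndHom`, `PontryaginTateDualInverseLimitScalars.lean`), the pairing (5) of Greenberg 2010
satisfies `⟪θ_* t, y⟫_v = ⟪t, θ̂_* y⟫_v` (`limitPairing_cohomologyMap_end`): at a level `k` where `t`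
lives this is the adjointness of the cup product for the pair `(θ|_{D_k}, (f ↦ f ∘ θ)|_{Hom(D_k, μ)})`
— the tree's `zmodToQmodZ_localTatePairingZMod_map_eq_of_levelChange` at equal levels `p^k ∣ p^k`
— together with `(θ̂_* y)_k = (θ̂_k)_* y_k` (`localProj_cohomologyMap_end`; the equivariance `layerDualEnd_layerDualRep` and the global twin
`cohomologyMap_projHom_dualEndHom` are the tree's `PontryaginTateDualInverseLimitEquivariance.lean`).  This is what makes
`y ↦ ⟪·, y⟫` a `Λ`-compatible map `H¹_cont(K_v, T*) → H¹(K_v, D)^∨` ("a nondegenerate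
`Λ`-pairing", Greenberg 2010 §3.1).  Both endomorphisms are consumed as morphisms of topological
representations SPECIFIED POINTWISE (`hΘ`, `hΘ'`), so restrictions of `E.dualEndHom` along
`Γ_{K_v} → Γ_K` in any spelling can be fed.

HONESTY: plumbing; no statement about Selmer groups, Greenberg's propositions or BSD is proved.
AI formalisation, weaker than expert review; the statements are established only by the kernel check.

## References
* R. Greenberg, *Surjectivity of the global-to-local map defining a Selmer group*, Kyoto J. Math.
  50 (2010) 853–888, §2 (5) p. 6, §3.1 (9) p. 14. [Greenberg2010]
* J. Neukirch, A. Schmidt, K. Wingberg, *Cohomology of Number Fields*, 2nd ed. (2008), I §4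
  Prop. (1.4.2) (functoriality of the cup product). [NeukirchSchmidtWingberg2008]
-/

noncomputable section

open Function CategoryTheory NumberField IsDedekindDomain Field
open _root_.TopRep _root_.ContRepresentation _root_.ContinuousCohomology
open scoped ContRepresentation
open Literature.NumberTheory.GaloisRepresentations.DiscreteGaloisModule
open Literature.NumberTheory.GaloisCohomology (LocalInvariants)
open Literature.AnabelianGeometry.AbsoluteAnabelian.Prop121vii (zmodToQmodZ)

namespace Literature.NumberTheory.GaloisRepresentations

namespace DiscreteGaloisModule.TorsionLayers

variable {K : Type} [Field K] [NumberField K] {D : Type} [AddCommGroup D] [TopologicalSpace D]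
  [DiscreteTopology D] {τ : DiscreteGaloisModule K D} {p : ℕ} (E : τ.TorsionLayers p)
  (θ : D →+ D) (hθ : ∀ (k : ℕ), ∀ d ∈ E.N k, θ d ∈ E.N k)

/-- `θ|_{D_k}` as an endomorphism of the local module `D_k|_{Γ_{K_v}}`. [cite: Greenberg2010, §2 p. 6 L5–8] -/
theorem layerEnd_toLocal_comm (hθτ : ∀ (σ : absoluteGaloisGroup K) (d : D), θ (τ σ d) = τ σ (θ d))
    (v : Place K) (k : ℕ) (σ : absoluteGaloisGroup (Place.Completion v)) (x : E.N k) :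
    E.layerEnd θ hθ k (((E.layerRep k).toLocal v) σ x) = ((E.layerRep k).toLocal v) σ (E.layerEnd θ hθ k x) :=
  Subtype.ext (hθτ _ x)

/-- **`(θ̂_* y)_k = (θ̂_k)_* y_k`**: the level components of `H¹(θ̂) y` are `H¹` of `f ↦ f ∘ θ` on
`Hom(D_k, μ_{p^k})` applied to `y_k`, for any morphism `Θ'` of `T*|_{Γ_{K_v}}` acting as `θ̂`.
[cite: Greenberg2010, §2 p. 6 L5–8] -/
theorem localProj_cohomologyMap_end (hθτ : ∀ (σ : absoluteGaloisGroup K) (d : D), θ (τ σ d) = τ σ (θ d))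
    (v : Place K) (k : ℕ)
    (Θ' : (E.localDualSystem v).limitRep.toTopRep ⟶ (E.localDualSystem v).limitRep.toTopRep)
    (hΘ' : ∀ x, Θ'.hom x = E.dualEnd θ hθ x)
    (y : continuousCohomology 1 (E.localDualSystem v).limitRep.toTopRep) :
    E.localProj v k (cohomologyMap Θ' 1 y) =
      cohomologyMap (TopRep.ofHom ⟨⟨(E.layerDualEnd θ hθ k).toIntLinearMap,
          continuous_of_discreteTopology⟩, fun σ => ContinuousLinearMap.ext fun f =>
            E.layerDualEnd_layerDualRep θ hθ hθτ k (absGaloisRestrict K _ σ) f⟩ :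
        ((E.layerDualRep k).toLocal v).toTopRep ⟶ ((E.layerDualRep k).toLocal v).toTopRep) 1
        (E.localProj v k y) := by
  rw [localProj_apply, localProj_apply]
  -- both composites `proj_k ∘ Θ'` and `θ̂_k ∘ proj_k` are the morphism `x ↦ x_k ∘ θ`
  let c : (E.localDualSystem v).limitRep.toTopRep ⟶ ((E.layerDualRep k).toLocal v).toTopRep :=
    TopRep.ofHom ⟨⟨((E.dualSystem.projAddHom k).comp (E.dualEnd θ hθ)).toIntLinearMap,
      ((E.localDualSystem v).continuous_projAddHom k).comp (E.continuous_dualEnd θ hθ)⟩,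
      fun σ => ContinuousLinearMap.ext fun x =>
        E.layerDualEnd_layerDualRep θ hθ hθτ k (absGaloisRestrict K _ σ) _⟩
  have h1 := ContinuousRep.cohomologyMap_comp_apply_of_eq_one
    (σ := (E.localDualSystem v).limitRep) (σ' := (E.localDualSystem v).limitRep)
    (ρ := (E.layerDualRep k).toLocal v) Θ' ((E.localDualSystem v).projHom k) c
    (fun x => by rw [hΘ']; rfl) y
  have h2 := ContinuousRep.cohomologyMap_comp_apply_of_eq_one
    (σ := (E.localDualSystem v).limitRep) (σ' := (E.layerDualRep k).toLocal v)
    (ρ := (E.layerDualRep k).toLocal v) ((E.localDualSystem v).projHom k)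
    (TopRep.ofHom ⟨⟨(E.layerDualEnd θ hθ k).toIntLinearMap, continuous_of_discreteTopology⟩,
      fun σ => ContinuousLinearMap.ext fun f =>
        E.layerDualEnd_layerDualRep θ hθ hθτ k (absGaloisRestrict K _ σ) f⟩)
    c (fun _ => rfl) y
  exact h1.trans h2.symm

variable [NeZero p] (inv : ∀ k : ℕ, LocalInvariants K (p ^ k))

/-- **Adjointness at one level**: `ι_{p^k} ⟨(θ|_{D_k})_* t', z⟩ = ι_{p^k} ⟨t', (θ̂_k)_* z⟩` (functoriality
of the cup product for the adjoint pair `(θ, f ↦ f ∘ θ)`; the tree's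
`zmodToQmodZ_localTatePairingZMod_map_eq_of_levelChange` at equal levels).
[cite: NeukirchSchmidtWingberg2008, I §4 Prop. (1.4.2)] [cite: Greenberg2010, §2 (5) p. 6] -/
theorem levelPairing_end (hθτ : ∀ (σ : absoluteGaloisGroup K) (d : D), θ (τ σ d) = τ σ (θ d))
    (v : Place K) (hinv : InvLevelLaw inv v) (k : ℕ)
    (t' : galoisCohomology ((E.layerRep k).toLocal v) 1)
    (Θ' : (E.localDualSystem v).limitRep.toTopRep ⟶ (E.localDualSystem v).limitRep.toTopRep)
    (hΘ' : ∀ x, Θ'.hom x = E.dualEnd θ hθ x)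
    (y : continuousCohomology 1 (E.localDualSystem v).limitRep.toTopRep) :
    E.levelPairing inv v k (cohomologyMap (TopRep.ofHom ⟨⟨(E.layerEnd θ hθ k).toIntLinearMap,
        continuous_of_discreteTopology⟩, fun σ => ContinuousLinearMap.ext fun x =>
          E.layerEnd_toLocal_comm θ hθ hθτ v k σ x⟩ :
        ((E.layerRep k).toLocal v).toTopRep ⟶ ((E.layerRep k).toLocal v).toTopRep) 1 t') y =
      E.levelPairing inv v k t' (cohomologyMap Θ' 1 y) := by
  haveI := E.finite k
  rw [levelPairing_apply, levelPairing_apply, E.localProj_cohomologyMap_end θ hθ hθτ v k Θ' hΘ' y]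
  exact zmodToQmodZ_localTatePairingZMod_map_eq_of_levelChange (E.layerRep k) (E.layerRep k)
    (dvd_refl (p ^ k))
    ⟨⟨(E.layerEnd θ hθ k).toIntLinearMap, continuous_of_discreteTopology⟩, fun σ =>
      ContinuousLinearMap.ext fun x => Subtype.ext (hθτ σ x)⟩
    ⟨⟨(E.layerDualEnd θ hθ k).toIntLinearMap, continuous_of_discreteTopology⟩, fun σ =>
      ContinuousLinearMap.ext fun f => E.layerDualEnd_layerDualRep θ hθ hθτ k σ f⟩
    (fun g m => muVal_injective K (p ^ k) rfl) (muInclHom K (dvd_refl (p ^ k))).hom (fun _ => rfl) v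
    (inv k v) (inv k v) (hinv le_rfl _ fun _ => rfl) t' (E.localProj v k y)

/-- **`⟪θ_* t, y⟫ = ⟪t, θ̂_* y⟫`** for the `Λ`-adic local pairing (Greenberg 2010 (5)/(9): "a
nondegenerate `Λ`-pairing"), for any morphisms `Θ` of `D|_{Γ_{K_v}}` acting as `θ` and `Θ'` of
`T*|_{Γ_{K_v}}` acting as `θ̂` (pointwise specifications `hΘ`, `hΘ'`).
[cite: Greenberg2010, §3.1 (9) p. 14] [cite: NeukirchSchmidtWingberg2008, I §4 Prop. (1.4.2)] -/
theorem limitPairing_cohomologyMap_end (hθτ : ∀ (σ : absoluteGaloisGroup K) (d : D), θ (τ σ d) = τ σ (θ d))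
    (v : Place K) (hinv : InvLevelLaw inv v)
    (Θ : (τ.toLocal v).toTopRep ⟶ (τ.toLocal v).toTopRep) (hΘ : ∀ d, Θ.hom d = θ d)
    (Θ' : (E.localDualSystem v).limitRep.toTopRep ⟶ (E.localDualSystem v).limitRep.toTopRep)
    (hΘ' : ∀ x, Θ'.hom x = E.dualEnd θ hθ x)
    (t : galoisCohomology (τ.toLocal v) 1)
    (y : continuousCohomology 1 (E.localDualSystem v).limitRep.toTopRep) :
    E.limitPairing inv v hinv (cohomologyMap Θ 1 t) y = E.limitPairing inv v hinv t (cohomologyMap Θ' 1 y) := by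
  obtain ⟨k, t', rfl⟩ := E.exists_localSubtypeMap_eq v t
  -- `Θ_* ((D_k ⊆ D)_* t') = (D_k ⊆ D)_* ((θ|_{D_k})_* t')`
  have hcomm : cohomologyMap Θ 1 (E.localSubtypeMap v k t') = E.localSubtypeMap v k
      (cohomologyMap (TopRep.ofHom ⟨⟨(E.layerEnd θ hθ k).toIntLinearMap,
        continuous_of_discreteTopology⟩, fun σ => ContinuousLinearMap.ext fun x =>
          E.layerEnd_toLocal_comm θ hθ hθτ v k σ x⟩ :
        ((E.layerRep k).toLocal v).toTopRep ⟶ ((E.layerRep k).toLocal v).toTopRep) 1 t') := by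
    rw [localSubtypeMap_apply, localSubtypeMap_apply]
    have h1 := ContinuousRep.cohomologyMap_comp_apply_of_eq_one
      (σ := (E.layerRep k).toLocal v) (σ' := τ.toLocal v) (ρ := τ.toLocal v)
      (TopRep.ofHom ⟨((E.layerSubtypeHom k).hom.restrictField (Place.Completion v)).toContinuousLinearMap,
        ((E.layerSubtypeHom k).hom.restrictField (Place.Completion v)).isIntertwining'⟩) Θ
      (TopRep.ofHom ⟨⟨((E.N k).subtype.toAddMonoidHom.toIntLinearMap.comp
          (E.layerEnd θ hθ k).toIntLinearMap), continuous_of_discreteTopology⟩, fun σ =>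
          ContinuousLinearMap.ext fun x => hθτ _ (x : D)⟩)
      (fun x => by rw [hΘ]; rfl) t'
    have h2 := ContinuousRep.cohomologyMap_comp_apply_of_eq_one
      (σ := (E.layerRep k).toLocal v) (σ' := (E.layerRep k).toLocal v) (ρ := τ.toLocal v)
      (TopRep.ofHom ⟨⟨(E.layerEnd θ hθ k).toIntLinearMap, continuous_of_discreteTopology⟩,
        fun σ => ContinuousLinearMap.ext fun x => E.layerEnd_toLocal_comm θ hθ hθτ v k σ x⟩)
      (TopRep.ofHom ⟨((E.layerSubtypeHom k).hom.restrictField (Place.Completion v)).toContinuousLinearMap,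
        ((E.layerSubtypeHom k).hom.restrictField (Place.Completion v)).isIntertwining'⟩)
      (TopRep.ofHom ⟨⟨((E.N k).subtype.toAddMonoidHom.toIntLinearMap.comp
          (E.layerEnd θ hθ k).toIntLinearMap), continuous_of_discreteTopology⟩, fun σ =>
          ContinuousLinearMap.ext fun x => hθτ _ (x : D)⟩)
      (fun _ => rfl) t'
    exact h1.trans h2.symm
  rw [hcomm, limitPairing_localSubtypeMap hinv, limitPairing_localSubtypeMap hinv]
  exact E.levelPairing_end θ hθ inv hθτ v hinv k t' Θ' hΘ' y

end DiscreteGaloisModule.TorsionLayers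

end Literature.NumberTheory.GaloisRepresentations
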